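import Literature.NumberTheory.Transcendental.CalegariDimitrovTangL2Chi3Period
import Mathlib.MeasureTheory.Constructions.Pi
import Mathlib.Tactic
import HarnessLib

/-!
# `L(2, χ₋₃)` as a box integral: `∫_{(0,1)²} dx₀dx₁/(1 + x₀x₁ + (x₀x₁)²) = Σ_{n≥0}(1/(3n+1)² − 1/(3n+2)²)`
on the open unit box of `Fin 2 → ℝ`

The period of Calegari–Dimitrov–Tang's Theorem 1 (arXiv:2408.15403, p. 3, printed as
`L(2,χ₋₃) = ∬_{1≥y≥x≥0} dxdy/(y(1+x+x²))`; box form `∬_{[0,1]²} ds dt/(1+st+s²t²)`, the `n = 0`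
term of eq. (Cintegral), p. 102) written in the literal shape
`∫ x in {x : Fin 2 → ℝ | ∀ i, x i ∈ Ioo 0 1}, …` of the Kontsevich–Zagier calculus of the tree
(`Literature.NumberTheory.Transcendental.KZ.IntegralRep`, `KZ.unitCube`; cf. the inline set
integrals of `BeukersZetaThreeIntegrals.lean`), as quoted by route items (summit
KontsevichZagierPeriods, route HurwitzMicroSectors: "`1/(1+xy+x²y²)` … is integrable on the open
unit box and `∫∫ = Σ_(n≥0)(1/(3n+1)² − 1/(3n+2)²) = L(2,χ₋₃)`"):

* `box_integral_L_two_chi_three` (`integrableOn_box_kernel_chi3`, `setIntegral_box_kernel_chi3`) —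
  **integrability and `∫_{(0,1)²} dx₀dx₁/(1 + x₀x₁ + (x₀x₁)²) = Σ_{n≥0}(1/(3n+1)² − 1/(3n+2)²)
  (= L2chi3)`**, transported from the closed-square evaluation
  `CalegariDimitrovTang.setIntegral_unitSquare_kernel` of `…L2Chi3Period.lean` (the boundary of the
  square is null);
* the transport lemmas `setIntegral_box_two_eq`, `integrableOn_box_two_iff` between the open box
  of `Fin 2 → ℝ` and the open square of `ℝ × ℝ` (`MeasurableEquiv.finTwoArrow`,
  `volume_preserving_finTwoArrow`), and the `ℝ × ℝ` statements `setIntegral_Ioo_sq_kernel_chi3`,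
  `integrableOn_Ioo_sq_kernel_chi3`.

No named facts (D-0026); everything is proved. The companion `ζ(n)` box integrals
(`∫_{(0,1)ⁿ} dx/(1 − x₀⋯x_{n−1}) = ζ(n)`, in particular `π²/6` and `ζ(3)`) are in
`BoxIntegralZetaValues.lean`.

## References

* [CalegariDimitrovTang2024] F. Calegari, V. Dimitrov, Y. Tang, arXiv:2408.15403, Thm. 1 (p. 3) and
  §11.1 eq. (Cintegral) (p. 102).
-/

noncomputable section

open MeasureTheory Set Filter Real

namespace Literature.NumberTheory.Transcendental

/-! ### The open unit square in `ℝ × ℝ` -/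

/-- The open unit square is measurable. [folklore] -/
theorem measurableSet_Ioo_sq : MeasurableSet (Ioo (0 : ℝ) 1 ×ˢ Ioo (0 : ℝ) 1) :=
  measurableSet_Ioo.prod measurableSet_Ioo

/-- The open unit square agrees with the closed one up to a Lebesgue-null set. [folklore] -/
theorem Ioo_sq_ae_eq_Icc_sq :
    (Ioo (0 : ℝ) 1 ×ˢ Ioo (0 : ℝ) 1 : Set (ℝ × ℝ)) =ᵐ[volume] (Icc (0 : ℝ) 1 ×ˢ Icc (0 : ℝ) 1) := by
  rw [Measure.volume_eq_prod]
  exact Measure.set_prod_ae_eq Ioo_ae_eq_Icc Ioo_ae_eq_Icc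

/-! ### `∬_{(0,1)²} ds dt/(1 + st + s²t²) = L(2, χ₋₃)` on the open square -/

/-- `1/(1 + st + (st)²)` is integrable on the open unit square (it is continuous on the closed
one). [cite: CalegariDimitrovTang2024, Thm. 1 (p. 3)] -/
theorem integrableOn_Ioo_sq_kernel_chi3 :
    IntegrableOn (fun p : ℝ × ℝ => 1 / (1 + p.1 * p.2 + (p.1 * p.2) ^ 2))
      (Ioo (0 : ℝ) 1 ×ˢ Ioo (0 : ℝ) 1) volume := by
  have hcont : Continuous fun p : ℝ × ℝ => 1 / (1 + p.1 * p.2 + (p.1 * p.2) ^ 2) :=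
    Continuous.div continuous_const (by fun_prop) fun p =>
      (CalegariDimitrovTang.kernel_den_pos (p.1 * p.2)).ne'
  exact (ContinuousOn.integrableOn_compact CalegariDimitrovTang.isCompact_unitSquare
    hcont.continuousOn).mono_set (prod_mono Ioo_subset_Icc_self Ioo_subset_Icc_self)

/-- **`∬_{(0,1)²} ds dt/(1 + st + s²t²) = L(2, χ₋₃)`** on the open square (from the closed-square
evaluation `CalegariDimitrovTang.setIntegral_unitSquare_kernel`; the boundary is null).
[cite: CalegariDimitrovTang2024, Thm. 1 (p. 3)] -/
theorem setIntegral_Ioo_sq_kernel_chi3 :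
    ∫ p in Ioo (0 : ℝ) 1 ×ˢ Ioo (0 : ℝ) 1, 1 / (1 + p.1 * p.2 + (p.1 * p.2) ^ 2) = L2chi3 := by
  rw [setIntegral_congr_set Ioo_sq_ae_eq_Icc_sq, ← CalegariDimitrovTang.setIntegral_unitSquare_kernel]
  refine setIntegral_congr_fun CalegariDimitrovTang.measurableSet_unitSquare fun p _ => ?_
  rw [mul_pow]

/-! ### Transport to the open unit box of `Fin 2 → ℝ` -/

/-- The open unit box of `Fin 2 → ℝ` is the preimage of the open unit square under
`(x ↦ (x 0, x 1))`. [folklore] -/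
theorem box_two_eq_preimage :
    {x : Fin 2 → ℝ | ∀ i, x i ∈ Ioo (0 : ℝ) 1}
      = MeasurableEquiv.finTwoArrow ⁻¹' (Ioo (0 : ℝ) 1 ×ˢ Ioo (0 : ℝ) 1) := by
  ext x
  simp [Fin.forall_fin_two, MeasurableEquiv.finTwoArrow_apply]

/-- **Transport of integrals** from the open box of `Fin 2 → ℝ` to the open square of `ℝ × ℝ`
(`finTwoArrow` is a volume-preserving measurable equivalence). [folklore] -/
theorem setIntegral_box_two_eq (g : ℝ × ℝ → ℝ) :
    ∫ x in {x : Fin 2 → ℝ | ∀ i, x i ∈ Ioo (0 : ℝ) 1}, g (x 0, x 1)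
      = ∫ p in Ioo (0 : ℝ) 1 ×ˢ Ioo (0 : ℝ) 1, g p := by
  rw [box_two_eq_preimage]
  exact (volume_preserving_finTwoArrow ℝ).setIntegral_preimage_emb
    (MeasurableEquiv.measurableEmbedding _) g _

/-- **Transport of integrability** between the open box and the open square. [folklore] -/
theorem integrableOn_box_two_iff (g : ℝ × ℝ → ℝ) :
    IntegrableOn (fun x : Fin 2 → ℝ => g (x 0, x 1)) {x : Fin 2 → ℝ | ∀ i, x i ∈ Ioo (0 : ℝ) 1} volume
      ↔ IntegrableOn g (Ioo (0 : ℝ) 1 ×ˢ Ioo (0 : ℝ) 1) volume := by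
  rw [box_two_eq_preimage]
  exact (volume_preserving_finTwoArrow ℝ).integrableOn_comp_preimage
    (MeasurableEquiv.measurableEmbedding _)

/-- **`1/(1 + x₀x₁ + (x₀x₁)²)` is integrable on the open unit box `(0,1)²`.**
[cite: CalegariDimitrovTang2024, Thm. 1 (p. 3)] -/
theorem integrableOn_box_kernel_chi3 :
    IntegrableOn (fun x : Fin 2 → ℝ => 1 / (1 + x 0 * x 1 + (x 0 * x 1) ^ 2))
      {x | ∀ i, x i ∈ Ioo (0 : ℝ) 1} volume :=
  (integrableOn_box_two_iff (fun p : ℝ × ℝ => 1 / (1 + p.1 * p.2 + (p.1 * p.2) ^ 2))).mpr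
    integrableOn_Ioo_sq_kernel_chi3

/-- **`∫_{(0,1)²} dx/(1 + x₀x₁ + (x₀x₁)²) = L(2, χ₋₃)`** on the open unit box of `Fin 2 → ℝ`.
[cite: CalegariDimitrovTang2024, Thm. 1 (p. 3)] -/
theorem setIntegral_box_kernel_chi3 :
    ∫ x in {x : Fin 2 → ℝ | ∀ i, x i ∈ Ioo (0 : ℝ) 1}, 1 / (1 + x 0 * x 1 + (x 0 * x 1) ^ 2)
      = L2chi3 := by
  rw [← setIntegral_Ioo_sq_kernel_chi3]
  exact setIntegral_box_two_eq (fun p : ℝ × ℝ => 1 / (1 + p.1 * p.2 + (p.1 * p.2) ^ 2))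

/-- **Box integral of `L(2, χ₋₃)`, conjunction form with the printed series**:
`1/(1 + x₀x₁ + (x₀x₁)²)` is integrable on the open unit box and its integral is
`Σ_{n≥0} (1/(3n+1)² − 1/(3n+2)²)` (`= L2chi3` by definition). [cite: CalegariDimitrovTang2024, Thm. 1 (p. 3)] -/
theorem box_integral_L_two_chi_three :
    IntegrableOn (fun x : Fin 2 → ℝ => 1 / (1 + x 0 * x 1 + (x 0 * x 1) ^ 2))
        {x | ∀ i, x i ∈ Ioo (0 : ℝ) 1} volume ∧
      ∫ x in {x : Fin 2 → ℝ | ∀ i, x i ∈ Ioo (0 : ℝ) 1}, 1 / (1 + x 0 * x 1 + (x 0 * x 1) ^ 2)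
        = ∑' n : ℕ, (1 / (3 * (n : ℝ) + 1) ^ 2 - 1 / (3 * (n : ℝ) + 2) ^ 2) :=
  ⟨integrableOn_box_kernel_chi3, setIntegral_box_kernel_chi3⟩

end Literature.NumberTheory.Transcendental
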